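import Literature.Computability.AlgebraicComplexity.FlipGraphSymmetry
import HarnessLib

/-!
# Flip graphs with symmetry: orbit flips (Moosbauer–Poole 2025, Thm. 4)

Topic `Literature/Computability/AlgebraicComplexity`; companion of `FlipGraphSymmetry.lean` (the
symmetries `Symmetry t` of a 3-tensor, `Scheme.map`, MP Def. 2 `IsInvariantUnder`) and
`FlipGraphConnectivity.lean` (KM Def. 1 `Scheme`, multiset reading; Def. 4 flips; §6 MP Def. 3
plus-transitions). Source: J. Moosbauer, M. Poole, *Flip Graphs with Symmetry and New Matrix
Multiplication Schemes*, ISSAC 2025 = arXiv:2502.04514 (MP), §3, Theorem 4 with its proof and the two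
paragraphs following it. Everything here is PROVED; there are no named facts.

MP Thm. 4 (verbatim): "Let `n ∈ ℕ` and let `G ≤ S₃ ⋊ GL(n)^{×3}` be a finite subgroup of the symmetry
group of matrix multiplication. Let `S` be a `G`-invariant `n×n` matrix multiplication scheme and let
`T` be a set of representatives for the orbits of `G` in `S`. Let `A⊗B⊗C, A⊗B'⊗C'` be elements in `T`
with orbits of size `|G|`. Then there are `λ, λ' ∈ ℤ` such that
`S' = S ∖ (G·A⊗B⊗C ∪ G·A⊗B'⊗C') ∪ G·λA⊗B⊗(C+C') ∪ G·λ'A⊗(B'−B)⊗C'`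
is a `G`-invariant `n×n` matrix multiplication scheme. We call `S'` an orbit flip of `S`."
The printed proof: (i) for every `g ∈ G`,
`g·A⊗B⊗C + g·A⊗B'⊗C' = g·A⊗B⊗(C+C') + g·A⊗(B'−B)⊗C'` (the symmetry transformations act linearly);
(ii) "Since both `A⊗B⊗C` and `A⊗B'⊗C'` have full orbits, we get
`G·A⊗B⊗C + G·A⊗B'⊗C' = Σ_{g∈G} (g·A⊗B⊗(C+C') + g·A⊗(B'−B)⊗C')`"; (iii) with
`λ = |G| / |G·A⊗B⊗(C+C')|` "the orbit-stabilizer theorem guarantees that `λ` is an integer and that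
`Σ_{g∈G} g·A⊗B⊗(C+C') = λ Σ (G·A⊗B⊗(C+C'))`"; (iv) "note that if `K` has finite characteristic, then
both `λA⊗B⊗(C+C')` and `λ'A⊗(B'−B)⊗C` can be `0`" (such a piece is then absent). After the proof:
"Since reductions are a special case of flips and plus-transitions are an inverse reduction followed
by a flip, Theorem 4 also holds for reductions and plus-transitions. We call the corresponding
operations orbit reduction and orbit plus-transition", and the special case "if
`G·A⊗B⊗(C+C') = G·A⊗(B'−B)⊗C` … we double `λ` and set `λ'` to `0`".

## The setting in the tree's vocabulary

* The finite group `G` is an abstract finite group acting on the tensor space `K^{ι×κ×μ}` through a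
  `DistribMulAction` (every `g` acts additively — "the symmetry transformations act linearly");
  for the scheme-level statements the action is BY SYMMETRIES of `t` in the sense of
  `FlipGraphSymmetry.lean`: a map `ρ : G → Symmetry t` with `(ρ g) T = g • T`
  (`DistribMulAction.ofSymmetries` builds the action from such a `ρ`). MP's "`G`-invariant" is the
  tree's `IsInvariantUnder (Set.range ρ) S` (MP Def. 2), equivalently `g • S = S` for all `g`
  (`isInvariantUnder_range_iff`).
* Orbits `G·X` are the finite sets `orbitFinset G X`; `stabCard G X = |G_X|`;
  `card_orbitFinset_mul_stabCard` is the orbit–stabiliser count, so that MP's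
  `λ = |G| / |G·X| = orbitCoeff G X` is an integer equal to `|G_X|` (`orbitCoeff_eq_stabCard`), and
  `sum_univ_smul` is step (iii): `Σ_{g∈G} g•X = |G_X| • Σ (G·X)`.
* Schemes are the multisets of `FlipGraphConnectivity.lean` (KM Def. 1, multiset reading, under which
  the set formula for `S'` is literally a scheme: MP, like KM, do not discuss coincidences between the
  new orbits and the untouched part of `S`). The new orbit "`G·λX`" is the multiset
  `orbitPiece G X = {g • (λX) : g ∈ G}` indexed by the orbit of `X` (`mem_orbitPiece`), EMPTY when
  `λX = 0` (step (iv)); `S'` is `S − (G·T₁ + G·T₂) + orbitPiece X + orbitPiece Y`.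

## Contents

* §1 orbits of a finite group action as finite sets, the orbit–stabiliser count, the orbit sum (iii).
* §2 the pieces `orbitPieceWith n X = G·(nX)` and `orbitPiece`, their sums and `G`-invariance.
* §3 the core of the proof on multisets (`orbitMove_sum_and_invariant`): removing two full orbits
  `G·T₁, G·T₂` from a `G`-invariant multiset and adding any `G`-invariant multiset whose sum is
  `Σ_g g•(T₁+T₂)` keeps the sum and the invariance; the pieces of any `P` with `T₁ + T₂ = Σ P` qualify
  (`sum_bind_orbitPiece`), which is steps (i)–(ii).
* §4 schemes of a tensor `t` over a field: **MP Thm. 4** `moosbauerPoole2025_thm4` (orbit flip, as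
  printed, shared first factor), `moosbauerPoole2025_thm4_general` (any replacement `T₁ + T₂ = Σ P` by
  rank-one tensors — "these definitions apply for arbitrary permutations of `A, B` and `C`", all six
  flip identities of `FlipGraphMoves.lean` qualify), `moosbauerPoole2025_orbitReduction`,
  `moosbauerPoole2025_orbitPlusTransition` ("Theorem 4 also holds for reductions and
  plus-transitions"), `moosbauerPoole2025_thm4_special` (the case `G·X = G·Y`: `2λ` and `λ' = 0`), and
  the rank bookkeeping `|S'| + 2|G| = |S| + |pieces|`.

## References

* J. Moosbauer, M. Poole, *Flip Graphs with Symmetry and New Matrix Multiplication Schemes*,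
  Proc. ISSAC 2025, doi:10.1145/3747199.3747566, arXiv:2502.04514: §2 Def. 2, §3 Def. 3, Thm. 4 with
  its proof and the two paragraphs after it. [MoosbauerPoole2025]
* M. Kauers, J. Moosbauer, *Flip Graphs for Matrix Multiplication*, ISSAC 2023, arXiv:2212.01175,
  Def. 1, Def. 4. [KauersMoosbauer2022FlipGraphs]
-/

namespace Literature.Computability.AlgebraicComplexity

open scoped BigOperators
open Multiset

namespace FlipGraph

/-! ## §1 Orbits of a finite group action as finite sets; orbit–stabiliser; the orbit sum -/

section Orbit

variable {G : Type*} [Group G] [Fintype G] {V : Type*} [DecidableEq V] [MulAction G V]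

/-- The orbit `G · X = {g • X : g ∈ G}` of `X` under the finite group `G`, as a finite set
(MP: "`G · t`", the orbit of a rank-one tensor).
[cite: MoosbauerPoole2025, Def. 2 (orbits of `G` in `S`)] -/
def orbitFinset (G : Type*) [Group G] [Fintype G] {V : Type*} [DecidableEq V] [MulAction G V]
    (X : V) : Finset V :=
  Finset.univ.image fun g : G => g • X

/-- Membership in the orbit. [cite: MoosbauerPoole2025, Def. 2 (orbits of `G` in `S`)] -/
theorem mem_orbitFinset {X Y : V} : Y ∈ orbitFinset G X ↔ ∃ g : G, g • X = Y := by
  simp only [orbitFinset, Finset.mem_image, Finset.mem_univ, true_and]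

/-- `orbitFinset G X` is Mathlib's orbit `MulAction.orbit G X` as a finite set.
[cite: MoosbauerPoole2025, §2 (after Def. 2: "`S` can be partitioned into orbits under the action
of `G`")] -/
theorem coe_orbitFinset (X : V) : (orbitFinset G X : Set V) = MulAction.orbit G X := by
  ext Y
  rw [Finset.mem_coe, mem_orbitFinset, MulAction.mem_orbit_iff]

/-- `g • X ∈ G · X`.
[cite: MoosbauerPoole2025, §2 (after Def. 2: "`S` can be partitioned into orbits under the action
of `G`")] -/
theorem smul_mem_orbitFinset (g : G) (X : V) : g • X ∈ orbitFinset G X :=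
  mem_orbitFinset.mpr ⟨g, rfl⟩

/-- `X ∈ G · X`.
[cite: MoosbauerPoole2025, §2 (after Def. 2: "`S` can be partitioned into orbits under the action
of `G`")] -/
theorem mem_orbitFinset_self (X : V) : X ∈ orbitFinset G X :=
  mem_orbitFinset.mpr ⟨1, one_smul G X⟩

/-- Orbits are non-empty.
[cite: MoosbauerPoole2025, §2 (after Def. 2: "`S` can be partitioned into orbits under the action
of `G`")] -/
theorem orbitFinset_nonempty (X : V) : (orbitFinset G X).Nonempty :=
  ⟨X, mem_orbitFinset_self X⟩

/-- `G · (g • X) = G · X`.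
[cite: MoosbauerPoole2025, §2 (after Def. 2: "`S` can be partitioned into orbits under the action
of `G`")] -/
theorem orbitFinset_smul (g : G) (X : V) : orbitFinset G (g • X) = orbitFinset G X := by
  ext Y
  simp only [mem_orbitFinset]
  constructor
  · rintro ⟨h, rfl⟩
    exact ⟨h * g, mul_smul h g X⟩
  · rintro ⟨h, rfl⟩
    exact ⟨h * g⁻¹, by rw [mul_smul, inv_smul_smul]⟩

/-- Elements of one orbit have the same orbit (the orbits partition).
[cite: MoosbauerPoole2025, §2 (after Def. 2: "`S` can be partitioned into orbits under the action
of `G`")] -/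
theorem orbitFinset_eq_of_mem {X Y : V} (h : Y ∈ orbitFinset G X) :
    orbitFinset G Y = orbitFinset G X := by
  obtain ⟨g, rfl⟩ := mem_orbitFinset.mp h
  exact orbitFinset_smul g X

/-- **Orbits are `G`-invariant:** `g • (G · X) = G · X`.
[cite: MoosbauerPoole2025, §2 (after Def. 2: "`S` can be partitioned into orbits under the action
of `G`")] -/
theorem image_smul_orbitFinset (g : G) (X : V) :
    (orbitFinset G X).image (fun Y => g • Y) = orbitFinset G X := by
  ext Y
  simp only [Finset.mem_image, mem_orbitFinset]
  constructor
  · rintro ⟨Z, ⟨h, rfl⟩, rfl⟩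
    exact ⟨g * h, mul_smul g h X⟩
  · rintro ⟨h, rfl⟩
    exact ⟨(g⁻¹ * h) • X, ⟨g⁻¹ * h, rfl⟩, by rw [← mul_smul, mul_inv_cancel_left]⟩

/-- Orbits are `G`-invariant, as multisets.
[cite: MoosbauerPoole2025, §2 (after Def. 2: "`S` can be partitioned into orbits under the action
of `G`")] -/
theorem map_smul_orbitFinset_val (g : G) (X : V) :
    (orbitFinset G X).val.map (fun Y => g • Y) = (orbitFinset G X).val := by
  rw [← Finset.image_val_of_injOn (MulAction.injective g).injOn, image_smul_orbitFinset]

/-- The order `|G_X|` of the stabiliser of `X`: the number of `g ∈ G` with `g • X = X`.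
[cite: MoosbauerPoole2025, Thm. 4 (proof: "orbit-stabilizer theorem")] -/
def stabCard (G : Type*) [Group G] [Fintype G] {V : Type*} [DecidableEq V] [MulAction G V]
    (X : V) : ℕ :=
  (Finset.univ.filter fun g : G => g • X = X).card

/-- `|G_X| ≥ 1` (the identity stabilises).
[cite: MoosbauerPoole2025, Thm. 4 (proof: "The orbit-stabilizer theorem")] -/
theorem one_le_stabCard (X : V) : 1 ≤ stabCard G X :=
  Finset.card_pos.mpr ⟨1, Finset.mem_filter.mpr ⟨Finset.mem_univ _, one_smul G X⟩⟩

/-- Every fibre of `g ↦ g • X` over the orbit is a coset of the stabiliser: it has `|G_X|` elements.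
[cite: MoosbauerPoole2025, Thm. 4 (proof: "The orbit-stabilizer theorem")] -/
theorem card_filter_smul_eq_smul (g₀ : G) (X : V) :
    (Finset.univ.filter fun g : G => g • X = g₀ • X).card = stabCard G X := by
  refine (Finset.card_equiv (Equiv.mulLeft g₀) fun g => ?_).symm
  simp only [Finset.mem_filter, Finset.mem_univ, true_and, Equiv.coe_mulLeft, mul_smul,
    smul_left_cancel_iff]

/-- **Orbit–stabiliser:** `|G · X| · |G_X| = |G|`. [cite: MoosbauerPoole2025, Thm. 4 (proof: "The
orbit-stabilizer theorem guarantees that `λ` is an integer")] -/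
theorem card_orbitFinset_mul_stabCard (X : V) :
    (orbitFinset G X).card * stabCard G X = Fintype.card G := by
  rw [← Finset.card_univ, Finset.card_eq_sum_card_image (fun g : G => g • X) Finset.univ]
  exact (Finset.sum_const_nat fun Y hY => by
    obtain ⟨g₀, rfl⟩ := mem_orbitFinset.mp hY
    exact card_filter_smul_eq_smul g₀ X).symm

/-- `|G · X|` divides `|G|`.
[cite: MoosbauerPoole2025, Thm. 4 (proof: "The orbit-stabilizer theorem")] -/
theorem card_orbitFinset_dvd (X : V) : (orbitFinset G X).card ∣ Fintype.card G :=
  Dvd.intro _ (card_orbitFinset_mul_stabCard X)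

/-- **MP's `λ = |G| / |G · X|` is the order of the stabiliser** (in particular an integer).
[cite: MoosbauerPoole2025, Thm. 4 (proof, definition of `λ, λ'`)] -/
theorem card_div_card_orbitFinset (X : V) :
    Fintype.card G / (orbitFinset G X).card = stabCard G X := by
  rw [← card_orbitFinset_mul_stabCard X,
    Nat.mul_div_cancel_left _ (Finset.card_pos.mpr (orbitFinset_nonempty X))]

/-- **"orbits of size `|G|`"** are exactly those with trivial stabiliser count.
[cite: MoosbauerPoole2025, Thm. 4 (hypothesis "with orbits of size `|G|`")] -/
theorem card_orbitFinset_eq_card_iff (X : V) :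
    (orbitFinset G X).card = Fintype.card G ↔ stabCard G X = 1 := by
  have h := card_orbitFinset_mul_stabCard (G := G) X
  constructor
  · intro hc
    rw [hc] at h
    exact Nat.eq_of_mul_eq_mul_left Fintype.card_pos (h.trans (mul_one _).symm)
  · intro hs
    rw [hs, mul_one] at h
    exact h

/-- … equivalently, only the identity fixes `X`.
[cite: MoosbauerPoole2025, Thm. 4 (proof: "The orbit-stabilizer theorem")] -/
theorem stabCard_eq_one_iff (X : V) : stabCard G X = 1 ↔ ∀ g : G, g • X = X → g = 1 := by
  rw [stabCard, Finset.card_eq_one]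
  constructor
  · rintro ⟨g₁, hg₁⟩ g hg
    have h1 : (1 : G) ∈ (Finset.univ.filter fun g : G => g • X = X) :=
      Finset.mem_filter.mpr ⟨Finset.mem_univ _, one_smul G X⟩
    have hg' : g ∈ (Finset.univ.filter fun g : G => g • X = X) :=
      Finset.mem_filter.mpr ⟨Finset.mem_univ _, hg⟩
    rw [hg₁, Finset.mem_singleton] at h1 hg'
    rw [hg', ← h1]
  · intro h
    refine ⟨1, ?_⟩
    ext g
    simp only [Finset.mem_filter, Finset.mem_univ, true_and, Finset.mem_singleton]
    exact ⟨h g, fun hg => by rw [hg, one_smul]⟩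

variable [AddCommMonoid V]

/-- **The orbit sum (MP's step (iii)):** `Σ_{g ∈ G} g • X = |G_X| • Σ (G · X)` — "the orbit-stabilizer
theorem guarantees that … `Σ_{g∈G} g·A⊗B⊗(C+C') = λ Σ (G·A⊗B⊗(C+C'))`".
[cite: MoosbauerPoole2025, Thm. 4 (proof)] -/
theorem sum_univ_smul (X : V) : ∑ g : G, g • X = stabCard G X • ∑ Y ∈ orbitFinset G X, Y :=
  calc ∑ g : G, g • X = ∑ g : G, (fun Y : V => Y) ((fun g : G => g • X) g) := rfl
    _ = ∑ Y ∈ Finset.univ.image (fun g : G => g • X),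
          (Finset.univ.filter fun g : G => (fun g : G => g • X) g = Y).card • (fun Y : V => Y) Y :=
        Finset.sum_comp (s := Finset.univ) (fun Y : V => Y) (fun g : G => g • X)
    _ = ∑ Y ∈ orbitFinset G X, (Finset.univ.filter fun g : G => g • X = Y).card • Y := rfl
    _ = ∑ Y ∈ orbitFinset G X, stabCard G X • Y := Finset.sum_congr rfl fun Y hY => by
        obtain ⟨g₀, rfl⟩ := mem_orbitFinset.mp hY
        rw [card_filter_smul_eq_smul]
    _ = stabCard G X • ∑ Y ∈ orbitFinset G X, Y := Finset.sum_nsmul _ _ _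

/-- The orbit sum, multiset form: `|G_X| • Σ (G · X) = Σ_{g ∈ G} g • X`.
[cite: MoosbauerPoole2025, Thm. 4 (proof)] -/
theorem stabCard_smul_sum_orbitFinset (X : V) :
    stabCard G X • (orbitFinset G X).val.sum = ∑ g : G, g • X := by
  rw [sum_univ_smul, Finset.sum_eq_multiset_sum, Multiset.map_id']

/-- **Full orbits (MP's step (ii)):** if `|G · T| = |G|` then `Σ_{g∈G} g • T = Σ (G · T)` — "Since both
`A⊗B⊗C` and `A⊗B'⊗C'` have full orbits, we get `G·A⊗B⊗C + … = Σ_{g∈G} (g·A⊗B⊗C + …)`".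
[cite: MoosbauerPoole2025, Thm. 4 (proof)] -/
theorem sum_univ_smul_of_full {X : V} (h : (orbitFinset G X).card = Fintype.card G) :
    ∑ g : G, g • X = (orbitFinset G X).val.sum := by
  rw [← stabCard_smul_sum_orbitFinset, (card_orbitFinset_eq_card_iff X).mp h, one_nsmul]

end Orbit

/-! ## §2 The new orbits `G · λX` as multisets -/

section Piece

variable {G : Type*} [Group G] [Fintype G] {V : Type*} [DecidableEq V] [AddCommMonoid V]
  [DistribMulAction G V]

omit [DecidableEq V] in
/-- `Σ_{g∈G} g • (Σ P) = Σ_{X ∈ P} Σ_{g∈G} g • X` (additivity of the action: "the symmetry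
transformations act linearly"). [cite: MoosbauerPoole2025, Thm. 4 (proof)] -/
theorem sum_univ_smul_multiset_sum (P : Multiset V) :
    ∑ g : G, g • P.sum = (P.map fun X => ∑ g : G, g • X).sum := by
  induction P using Multiset.induction_on with
  | empty => simp
  | cons X P ih =>
    simp only [Multiset.sum_cons, Multiset.map_cons, smul_add, Finset.sum_add_distrib, ih]

/-- **MP's coefficient `λ = |G| / |G · X|`.**
[cite: MoosbauerPoole2025, Thm. 4 (proof, definition of `λ`)] -/
def orbitCoeff (G : Type*) [Group G] [Fintype G] {V : Type*} [DecidableEq V] [MulAction G V]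
    (X : V) : ℕ :=
  Fintype.card G / (orbitFinset G X).card

/-- `λ = |G_X|`. [cite: MoosbauerPoole2025, Thm. 4 (proof: "`λ` is an integer")] -/
theorem orbitCoeff_eq_stabCard (X : V) : orbitCoeff G X = stabCard G X :=
  card_div_card_orbitFinset X

/-- The orbit of `n • X` presented along the orbit of `X`: the multiset `{g • (n • X) : g•X ∈ G·X}`
`= {n • Y : Y ∈ G · X}`, and EMPTY when `n • X = 0` ("if `K` has finite characteristic, then …
`λA⊗B⊗(C+C')` … can be `0`": a vanishing tensor is not a rank-one tensor, KM Def. 1, and is dropped).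
[cite: MoosbauerPoole2025, Thm. 4 (statement: "`G · λA⊗B⊗(C+C')`")] -/
def orbitPieceWith (G : Type*) [Group G] [Fintype G] {V : Type*} [DecidableEq V] [AddCommMonoid V]
    [DistribMulAction G V] (n : ℕ) (X : V) : Multiset V :=
  if n • X = 0 then 0 else (orbitFinset G X).val.map fun Y => n • Y

/-- **The new orbit `G · λX` of MP Thm. 4** (`λ = |G| / |G·X|`), as a multiset (empty if `λX = 0`).
[cite: MoosbauerPoole2025, Thm. 4 (statement)] -/
def orbitPiece (G : Type*) [Group G] [Fintype G] {V : Type*} [DecidableEq V] [AddCommMonoid V]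
    [DistribMulAction G V] (X : V) : Multiset V :=
  orbitPieceWith G (orbitCoeff G X) X

/-- The sum of `G · (nX)` along the orbit is `n • Σ (G·X)` (also when the piece is dropped: then every
`n • (g•X) = g • (nX) = 0`). [cite: MoosbauerPoole2025, Thm. 4 (proof)] -/
theorem sum_orbitPieceWith (n : ℕ) (X : V) :
    (orbitPieceWith G n X).sum = n • (orbitFinset G X).val.sum := by
  have key : ((orbitFinset G X).val.map fun Y => n • Y).sum = n • (orbitFinset G X).val.sum := by
    rw [Multiset.smul_sum]
  unfold orbitPieceWith
  split_ifs with h0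
  · rw [Multiset.sum_zero, ← key]
    refine (Multiset.sum_eq_zero fun Y hY => ?_).symm
    obtain ⟨Z, hZ, rfl⟩ := Multiset.mem_map.mp hY
    obtain ⟨g, rfl⟩ := mem_orbitFinset.mp (Finset.mem_val.mp hZ)
    rw [smul_comm n g X, h0, smul_zero]
  · exact key

/-- **`Σ (G · λX) … = Σ_{g∈G} g • X`** (steps (iii)–(iv) combined): the piece replaces the full sum
over the group. [cite: MoosbauerPoole2025, Thm. 4 (proof)] -/
theorem sum_orbitPiece (X : V) : (orbitPiece G X).sum = ∑ g : G, g • X := by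
  rw [orbitPiece, sum_orbitPieceWith, orbitCoeff_eq_stabCard, stabCard_smul_sum_orbitFinset]

/-- The pieces are `G`-invariant.
[cite: MoosbauerPoole2025, Thm. 4 ("is a `G`-invariant … scheme")] -/
theorem map_smul_orbitPieceWith (g : G) (n : ℕ) (X : V) :
    (orbitPieceWith G n X).map (fun Y => g • Y) = orbitPieceWith G n X := by
  unfold orbitPieceWith
  split_ifs with h0
  · rfl
  · rw [Multiset.map_map]
    have hc : ((fun Y : V => g • Y) ∘ fun Y => n • Y) = (fun Y => n • Y) ∘ fun Y : V => g • Y := by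
      funext Y
      exact smul_comm g n Y
    rw [hc, ← Multiset.map_map, map_smul_orbitFinset_val]

/-- `G · λX` is `G`-invariant. [cite: MoosbauerPoole2025, Thm. 4 ("is a `G`-invariant … scheme")] -/
theorem map_smul_orbitPiece (g : G) (X : V) :
    (orbitPiece G X).map (fun Y => g • Y) = orbitPiece G X :=
  map_smul_orbitPieceWith g _ X

/-- The elements of the piece are the `g • (nX)`, and there are none if `nX = 0`.
[cite: MoosbauerPoole2025, Thm. 4 (statement: the new orbits `G·λA⊗B⊗(C+C')`)] -/
theorem mem_orbitPieceWith {n : ℕ} {X Y : V} :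
    Y ∈ orbitPieceWith G n X ↔ n • X ≠ 0 ∧ ∃ g : G, Y = g • (n • X) := by
  unfold orbitPieceWith
  split_ifs with h0
  · simp [h0]
  · simp only [Multiset.mem_map, Finset.mem_val, mem_orbitFinset]
    constructor
    · rintro ⟨Z, ⟨g, rfl⟩, rfl⟩
      exact ⟨h0, g, smul_comm n g X⟩
    · rintro ⟨-, g, rfl⟩
      exact ⟨g • X, ⟨g, rfl⟩, smul_comm n g X⟩

/-- **The elements of `G · λX` are the `g • (λX)`, `g ∈ G`** (none if `λX = 0`).
[cite: MoosbauerPoole2025, Thm. 4 (statement)] -/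
theorem mem_orbitPiece {X Y : V} :
    Y ∈ orbitPiece G X ↔ orbitCoeff G X • X ≠ 0 ∧ ∃ g : G, Y = g • (orbitCoeff G X • X) :=
  mem_orbitPieceWith

/-- Elements of a piece are non-zero (KM Def. 1: rank-one tensors are non-zero).
[cite: MoosbauerPoole2025, Thm. 4 (statement: the new orbits `G·λA⊗B⊗(C+C')`)] -/
theorem ne_zero_of_mem_orbitPieceWith {n : ℕ} {X Y : V} (h : Y ∈ orbitPieceWith G n X) : Y ≠ 0 := by
  obtain ⟨h0, g, rfl⟩ := mem_orbitPieceWith.mp h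
  exact (smul_ne_zero_iff_ne g).mpr h0

/-- The number of elements of `G · (nX)` along the orbit: `|G · X|`, or `0` if `nX = 0`.
[cite: MoosbauerPoole2025, Thm. 4 (statement: the new orbits `G·λA⊗B⊗(C+C')`)] -/
theorem card_orbitPieceWith (n : ℕ) (X : V) :
    card (orbitPieceWith G n X) = if n • X = 0 then 0 else (orbitFinset G X).card := by
  unfold orbitPieceWith
  split_ifs <;> simp

/-- In particular a piece has at most `|G|` elements.
[cite: MoosbauerPoole2025, Thm. 4 (statement: the new orbits `G·λA⊗B⊗(C+C')`)] -/
theorem card_orbitPieceWith_le (n : ℕ) (X : V) : card (orbitPieceWith G n X) ≤ Fintype.card G := by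
  rw [card_orbitPieceWith]
  split_ifs
  · exact Nat.zero_le _
  · exact Nat.le_of_dvd Fintype.card_pos (card_orbitFinset_dvd X)

/-- `|G · λX| ≤ |G|`.
[cite: MoosbauerPoole2025, Thm. 4 (statement: the new orbits `G·λA⊗B⊗(C+C')`)] -/
theorem card_orbitPiece_le (X : V) : card (orbitPiece G X) ≤ Fintype.card G :=
  card_orbitPieceWith_le _ X

/-- When `nX ≠ 0` and `n • ·` is injective (e.g. on a vector space over a field in which `n ≠ 0`),
the piece IS the orbit `G · (nX)` as a finite set. [cite: MoosbauerPoole2025, Thm. 4 (statement)] -/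
theorem orbitPieceWith_eq_orbitFinset_val {n : ℕ} {X : V} (h0 : n • X ≠ 0)
    (hinj : Function.Injective fun Y : V => n • Y) :
    orbitPieceWith G n X = (orbitFinset G (n • X)).val := by
  rw [orbitPieceWith, if_neg h0, ← Finset.image_val_of_injOn hinj.injOn]
  congr 1
  ext Y
  simp only [Finset.mem_image, mem_orbitFinset]
  constructor
  · rintro ⟨Z, ⟨g, rfl⟩, rfl⟩
    exact ⟨g, (smul_comm n g X).symm⟩
  · rintro ⟨g, rfl⟩
    exact ⟨g • X, ⟨g, rfl⟩, smul_comm n g X⟩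

/-- The pieces of a multiset `P` of new tensors: `Σ_{X∈P} G · λ_X X`. Its sum is
`Σ_{g∈G} g • Σ P`. [cite: MoosbauerPoole2025, Thm. 4 (proof)] -/
theorem sum_bind_orbitPiece (P : Multiset V) :
    (P.bind (orbitPiece G)).sum = ∑ g : G, g • P.sum := by
  rw [Multiset.sum_bind, sum_univ_smul_multiset_sum]
  congr 1
  exact Multiset.map_congr rfl fun X _ => sum_orbitPiece X

/-- … and it is `G`-invariant. [cite: MoosbauerPoole2025, Thm. 4 (proof)] -/
theorem map_smul_bind_orbitPiece (g : G) (P : Multiset V) :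
    (P.bind (orbitPiece G)).map (fun Y => g • Y) = P.bind (orbitPiece G) := by
  rw [Multiset.map_bind]
  congr 1
  funext X
  exact map_smul_orbitPiece g X

end Piece

/-! ## §3 The core of the proof: replacing two full orbits (multisets) -/

section Core

variable {G : Type*} [Group G] [Fintype G] {V : Type*} [DecidableEq V] [AddCommMonoid V]
  [DistribMulAction G V]

/-- **MP Thm. 4, the computation:** let the `G`-invariant multiset `S` contain the two full orbits
`G·T₁`, `G·T₂`, `S = G·T₁ + G·T₂ + R`, and let `N` be any `G`-invariant multiset with
`Σ N = Σ_{g∈G} g • (T₁ + T₂)`. Then `S' = R + N` has `Σ S' = Σ S` and is `G`-invariant. (Steps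
(i)–(ii): `Σ G·T₁ + Σ G·T₂ = Σ_g (g•T₁ + g•T₂) = Σ_g g•(T₁+T₂)`.)
[cite: MoosbauerPoole2025, Thm. 4 (proof)] -/
theorem orbitMove_sum_and_invariant {S R N : Multiset V} {T₁ T₂ : V}
    (hS : S = (orbitFinset G T₁).val + (orbitFinset G T₂).val + R)
    (hinv : ∀ g : G, S.map (fun Y => g • Y) = S)
    (h₁ : (orbitFinset G T₁).card = Fintype.card G) (h₂ : (orbitFinset G T₂).card = Fintype.card G)
    (hN : N.sum = ∑ g : G, g • (T₁ + T₂)) (hNinv : ∀ g : G, N.map (fun Y => g • Y) = N) :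
    (R + N).sum = S.sum ∧ ∀ g : G, (R + N).map (fun Y => g • Y) = R + N := by
  constructor
  · have e : (orbitFinset G T₁).val.sum + (orbitFinset G T₂).val.sum = N.sum := by
      rw [hN, ← sum_univ_smul_of_full h₁, ← sum_univ_smul_of_full h₂, ← Finset.sum_add_distrib]
      exact Finset.sum_congr rfl fun g _ => (smul_add g T₁ T₂).symm
    rw [Multiset.sum_add, hS, Multiset.sum_add, Multiset.sum_add, e, add_comm]
  · intro g
    have hR : R.map (fun Y => g • Y) = R := by
      have h := hinv g
      rw [hS, Multiset.map_add, Multiset.map_add, map_smul_orbitFinset_val,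
        map_smul_orbitFinset_val] at h
      exact add_left_cancel h
    rw [Multiset.map_add, hR, hNinv g]

/-- **The pieces qualify:** for any multiset `P` of tensors with `T₁ + T₂ = Σ P` (a flip:
`P = {A⊗B⊗(C+C'), A⊗(B'−B)⊗C'}`; a reduction: one element; a plus-transition: three), replacing the
full orbits `G·T₁, G·T₂` by the pieces `Σ_{X∈P} G·λ_X X` keeps the sum and the `G`-invariance.
[cite: MoosbauerPoole2025, Thm. 4 (proof) and the paragraph after it] -/
theorem orbitMove_pieces {S R : Multiset V} {T₁ T₂ : V} (P : Multiset V)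
    (hS : S = (orbitFinset G T₁).val + (orbitFinset G T₂).val + R)
    (hinv : ∀ g : G, S.map (fun Y => g • Y) = S)
    (h₁ : (orbitFinset G T₁).card = Fintype.card G) (h₂ : (orbitFinset G T₂).card = Fintype.card G)
    (hP : T₁ + T₂ = P.sum) :
    (R + P.bind (orbitPiece G)).sum = S.sum ∧
      ∀ g : G, (R + P.bind (orbitPiece G)).map (fun Y => g • Y) = R + P.bind (orbitPiece G) :=
  orbitMove_sum_and_invariant hS hinv h₁ h₂ (by rw [sum_bind_orbitPiece, hP])
    (fun g => map_smul_bind_orbitPiece g P)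

/-- In a `G`-invariant multiset, two elements `T₁, T₂` from different orbits bring their whole orbits:
`G·T₁ + G·T₂ ≤ S`, so that `S = G·T₁ + G·T₂ + (S − (G·T₁ + G·T₂))` ("`S` can be partitioned into
orbits under the action of `G`", MP §2). [cite: MoosbauerPoole2025, §2 (after Def. 2)] -/
theorem orbits_add_le {S : Multiset V} (hinv : ∀ g : G, S.map (fun Y => g • Y) = S) {T₁ T₂ : V}
    (hT₁ : T₁ ∈ S) (hT₂ : T₂ ∈ S) (hne : T₂ ∉ orbitFinset G T₁) :
    (orbitFinset G T₁).val + (orbitFinset G T₂).val ≤ S := by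
  have hnodup : ((orbitFinset G T₁).val + (orbitFinset G T₂).val).Nodup := by
    refine Multiset.nodup_add.mpr ⟨(orbitFinset G T₁).nodup, (orbitFinset G T₂).nodup, ?_⟩
    refine Multiset.disjoint_left.mpr fun {Y} hY₁ hY₂ => hne ?_
    rw [← orbitFinset_eq_of_mem (Finset.mem_val.mp hY₁), orbitFinset_eq_of_mem (Finset.mem_val.mp hY₂)]
    exact mem_orbitFinset_self T₂
  refine (Multiset.le_iff_subset hnodup).mpr fun Y hY => ?_
  rcases Multiset.mem_add.mp hY with hY | hY
  · obtain ⟨g, rfl⟩ := mem_orbitFinset.mp (Finset.mem_val.mp hY)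
    rw [← hinv g]
    exact Multiset.mem_map_of_mem _ hT₁
  · obtain ⟨g, rfl⟩ := mem_orbitFinset.mp (Finset.mem_val.mp hY)
    rw [← hinv g]
    exact Multiset.mem_map_of_mem _ hT₂

/-- The partition `S = G·T₁ + G·T₂ + (S ∖ (G·T₁ ∪ G·T₂))`.
[cite: MoosbauerPoole2025, §2 (after Def. 2)] -/
theorem eq_orbits_add_sub {S : Multiset V} (hinv : ∀ g : G, S.map (fun Y => g • Y) = S) {T₁ T₂ : V}
    (hT₁ : T₁ ∈ S) (hT₂ : T₂ ∈ S) (hne : T₂ ∉ orbitFinset G T₁) :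
    S = (orbitFinset G T₁).val + (orbitFinset G T₂).val +
      (S - ((orbitFinset G T₁).val + (orbitFinset G T₂).val)) := by
  rw [add_comm, Multiset.sub_add_cancel (orbits_add_le hinv hT₁ hT₂ hne)]

end Core

/-! ## §4 Schemes: MP Thm. 4 (orbit flips), orbit reductions, orbit plus-transitions -/

section Scheme

variable {K : Type*} [Field K] {ι κ μ : Type*} {t : ι → κ → μ → K}

/-- Two schemes with the same elements are equal (bookkeeping). [folklore] -/
private theorem scheme_ext' {x y : Scheme t} (h : x.elts = y.elts) : x = y := by
  cases x; cases y; cases h; rfl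

/-- An integer multiple of a rank-one tensor is (zero or) rank-one: `n • (a⊗b⊗c) = (n a)⊗b⊗c`
(MP's `λA⊗B⊗(C+C')`). [cite: MoosbauerPoole2025, Thm. 4 (statement: the new orbits `G·λA⊗B⊗(C+C')`)] -/
theorem nsmul_triad (n : ℕ) (a : ι → K) (b : κ → K) (c : μ → K) :
    n • triad a b c = triad ((n : K) • a) b c := by
  funext x y z
  simp only [Pi.smul_apply, triad_apply, nsmul_eq_mul, smul_eq_mul]
  ring

variable {G : Type*} [Group G]

/-- **An action by symmetries of `t`:** a map `ρ : G → Symmetry t` with `ρ(1) = id` and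
`ρ(gh) = ρ(g) ∘ ρ(h)` makes `G` act on the tensor space, additively (MP: a finite subgroup `G` of the
symmetry group acting on `(K^{n×n})^{⊗3}`; then `(ρ g) T = g • T` holds by `rfl`).
[cite: MoosbauerPoole2025, §2 (the symmetry group and its action)] -/
@[reducible] def DistribMulAction.ofSymmetries (ρ : G → Symmetry t)
    (h1 : ∀ T, (ρ 1).toLinearEquiv T = T)
    (hmul : ∀ g h T, (ρ (g * h)).toLinearEquiv T = (ρ g).toLinearEquiv ((ρ h).toLinearEquiv T)) :
    DistribMulAction G (ι → κ → μ → K) where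
  smul g T := (ρ g).toLinearEquiv T
  one_smul := h1
  mul_smul := hmul
  smul_zero g := (ρ g).toLinearEquiv.map_zero
  smul_add g := (ρ g).toLinearEquiv.map_add

variable [DistribMulAction G (ι → κ → μ → K)]

/-- If the action is by the symmetries `ρ g`, mapping a multiset by `ρ g` is acting by `g`.
[folklore] -/
private theorem map_symmetry_eq_map_smul (ρ : G → Symmetry t)
    (hρ : ∀ (g : G) (T : ι → κ → μ → K), (ρ g).toLinearEquiv T = g • T) (g : G)
    (U : Multiset (ι → κ → μ → K)) :
    U.map (ρ g).toLinearEquiv = U.map (fun T => g • T) :=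
  Multiset.map_congr rfl fun T _ => hρ g T

/-- **MP Def. 2 for an action by symmetries:** `S` is `G`-invariant (`IsInvariantUnder (Set.range ρ) S`,
"for all `g ∈ G` we have `g · S = S`") iff `g • S = S` as multisets for every `g`.
[cite: MoosbauerPoole2025, Def. 2] -/
theorem isInvariantUnder_range_iff (ρ : G → Symmetry t)
    (hρ : ∀ (g : G) (T : ι → κ → μ → K), (ρ g).toLinearEquiv T = g • T) (S : Scheme t) :
    IsInvariantUnder (Set.range ρ) S ↔ ∀ g : G, S.elts.map (fun T => g • T) = S.elts := by
  constructor
  · intro h g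
    have e := congrArg Scheme.elts (h (ρ g) ⟨g, rfl⟩)
    rwa [Scheme.map_elts, map_symmetry_eq_map_smul ρ hρ] at e
  · rintro h φ ⟨g, rfl⟩
    exact scheme_ext' (by rw [Scheme.map_elts, map_symmetry_eq_map_smul ρ hρ, h g])

variable [Fintype G] [DecidableEq (ι → κ → μ → K)]

/-- Elements of a piece `G · (nX)` built from a rank-one-or-zero `X = a⊗b⊗c` are rank-one tensors
`g • ((n a)⊗b⊗c)` (symmetries map rank-one tensors to rank-one tensors).
[cite: MoosbauerPoole2025, Thm. 4 (proof: "`(U,V,W)·A⊗B⊗C = UAV⁻¹ ⊗ VBW⁻¹ ⊗ WCU⁻¹`")] -/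
theorem exists_triad_of_mem_orbitPieceWith (ρ : G → Symmetry t)
    (hρ : ∀ (g : G) (T : ι → κ → μ → K), (ρ g).toLinearEquiv T = g • T) {n : ℕ}
    {a : ι → K} {b : κ → K} {c : μ → K} {Y : ι → κ → μ → K}
    (hY : Y ∈ orbitPieceWith G n (triad a b c)) :
    ∃ (a' : ι → K) (b' : κ → K) (c' : μ → K), Y = triad a' b' c' := by
  obtain ⟨-, g, rfl⟩ := mem_orbitPieceWith.mp hY
  obtain ⟨a', b', c', h⟩ := (ρ g).map_triad ((n : K) • a) b c
  exact ⟨a', b', c', by rw [nsmul_triad, ← hρ, h]⟩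

/-- **MP Thm. 4 in general form.** Let `G` act on `K^{ι×κ×μ}` by symmetries of `t`, let `S` be a
`G`-invariant scheme of `t`, and let `T₁, T₂ ∈ S` lie in different orbits, both of size `|G|`. For ANY
rank-one(-or-zero) tensors `P = {X₁, …, X_k}` with `T₁ + T₂ = X₁ + ⋯ + X_k` and any `G`-invariant
multiset `N` of non-zero rank-one tensors with `Σ N = Σ_g g • (T₁ + T₂)` — e.g. the pieces
`Σᵢ G·λᵢXᵢ` — the multiset `S' = (S ∖ (G·T₁ ∪ G·T₂)) + N` is a `G`-invariant scheme of `t`, and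
`|S'| + 2|G| = |S| + |N|`.
[cite: MoosbauerPoole2025, Thm. 4 with its proof and the paragraph after it] -/
theorem moosbauerPoole2025_thm4_core (ρ : G → Symmetry t)
    (hρ : ∀ (g : G) (T : ι → κ → μ → K), (ρ g).toLinearEquiv T = g • T)
    (S : Scheme t) (hS : IsInvariantUnder (Set.range ρ) S)
    {T₁ T₂ : ι → κ → μ → K} (hT₁ : T₁ ∈ S.elts) (hT₂ : T₂ ∈ S.elts)
    (h₁ : (orbitFinset G T₁).card = Fintype.card G) (h₂ : (orbitFinset G T₂).card = Fintype.card G)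
    (hne : T₂ ∉ orbitFinset G T₁)
    (N : Multiset (ι → κ → μ → K)) (hN : N.sum = ∑ g : G, g • (T₁ + T₂))
    (hNinv : ∀ g : G, N.map (fun Y => g • Y) = N) (hN0 : ∀ Y ∈ N, Y ≠ 0)
    (hN1 : ∀ Y ∈ N, ∃ (a : ι → K) (b : κ → K) (c : μ → K), Y = triad a b c) :
    ∃ S' : Scheme t,
      S'.elts = S.elts - ((orbitFinset G T₁).val + (orbitFinset G T₂).val) + N ∧
      IsInvariantUnder (Set.range ρ) S' ∧
      S'.rank + 2 * Fintype.card G = S.rank + card N := by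
  have hinv := (isInvariantUnder_range_iff ρ hρ S).mp hS
  have hdec := eq_orbits_add_sub hinv hT₁ hT₂ hne
  obtain ⟨hsum, hinv'⟩ := orbitMove_sum_and_invariant hdec hinv h₁ h₂ hN hNinv
  have hRle : S.elts - ((orbitFinset G T₁).val + (orbitFinset G T₂).val) ≤ S.elts :=
    Multiset.sub_le_self _ _
  refine ⟨⟨S.elts - ((orbitFinset G T₁).val + (orbitFinset G T₂).val) + N, fun T hT => ?_,
    fun T hT => ?_, by rw [hsum, S.sum_eq]⟩, rfl, ?_, ?_⟩
  · rcases Multiset.mem_add.mp hT with hT | hT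
    · exact S.ne_zero T (Multiset.mem_of_le hRle hT)
    · exact hN0 T hT
  · rcases Multiset.mem_add.mp hT with hT | hT
    · exact S.exists_triad T (Multiset.mem_of_le hRle hT)
    · exact hN1 T hT
  · exact (isInvariantUnder_range_iff ρ hρ _).mpr hinv'
  · have hc := congrArg card hdec
    simp only [Multiset.card_add, Finset.card_val, h₁, h₂] at hc
    simp only [Scheme.rank, Multiset.card_add]
    omega

/-- **MP Thm. 4 for any flip / reduction / plus-transition of the representatives:** as in
`moosbauerPoole2025_thm4_core`, with the new part the pieces `Σ_{X∈P} G·λ_X X` of any multiset `P` of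
rank-one(-or-zero) tensors with `T₁ + T₂ = Σ P` ("These definitions apply for arbitrary permutations of
`A, B` and `C`"; "Theorem 4 also holds for reductions and plus-transitions").
[cite: MoosbauerPoole2025, Thm. 4 and the paragraph after its proof] -/
theorem moosbauerPoole2025_thm4_general (ρ : G → Symmetry t)
    (hρ : ∀ (g : G) (T : ι → κ → μ → K), (ρ g).toLinearEquiv T = g • T)
    (S : Scheme t) (hS : IsInvariantUnder (Set.range ρ) S)
    {T₁ T₂ : ι → κ → μ → K} (hT₁ : T₁ ∈ S.elts) (hT₂ : T₂ ∈ S.elts)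
    (h₁ : (orbitFinset G T₁).card = Fintype.card G) (h₂ : (orbitFinset G T₂).card = Fintype.card G)
    (hne : T₂ ∉ orbitFinset G T₁)
    (P : Multiset (ι → κ → μ → K)) (hP : T₁ + T₂ = P.sum)
    (hP1 : ∀ X ∈ P, ∃ (a : ι → K) (b : κ → K) (c : μ → K), X = triad a b c) :
    ∃ S' : Scheme t,
      S'.elts = S.elts - ((orbitFinset G T₁).val + (orbitFinset G T₂).val) + P.bind (orbitPiece G) ∧
      IsInvariantUnder (Set.range ρ) S' ∧
      S'.rank + 2 * Fintype.card G = S.rank + card (P.bind (orbitPiece G)) := by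
  refine moosbauerPoole2025_thm4_core ρ hρ S hS hT₁ hT₂ h₁ h₂ hne _
    (by rw [sum_bind_orbitPiece, hP]) (fun g => map_smul_bind_orbitPiece g P) ?_ ?_
  · intro Y hY
    obtain ⟨X, -, hYX⟩ := Multiset.mem_bind.mp hY
    exact ne_zero_of_mem_orbitPieceWith hYX
  · intro Y hY
    obtain ⟨X, hX, hYX⟩ := Multiset.mem_bind.mp hY
    obtain ⟨a, b, c, rfl⟩ := hP1 X hX
    exact exists_triad_of_mem_orbitPieceWith ρ hρ hYX

/-- **MP Thm. 4 (orbit flip), as printed.** Let `G` be a finite group acting on `K^{ι×κ×μ}` by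
symmetries of `t` (`(ρ g) T = g • T`), `S` a `G`-invariant scheme of `t`, and `A⊗B⊗C, A⊗B'⊗C' ∈ S`
representatives of two different orbits of size `|G|`. Then, with `λ = |G| / |G·A⊗B⊗(C+C')|` and
`λ' = |G| / |G·A⊗(B'−B)⊗C'|` (natural numbers, `orbitCoeff`),
`S' = S ∖ (G·A⊗B⊗C ∪ G·A⊗B'⊗C') ∪ G·λA⊗B⊗(C+C') ∪ G·λ'A⊗(B'−B)⊗C'`
(multiset reading; a piece that is `0` is absent) is a `G`-invariant scheme of `t`: "We call `S'` an
orbit flip of `S`." Also `|S'| + 2|G| = |S| + |G·λX| + |G·λ'Y|` (pieces counted along the orbits of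
`X, Y`, absent pieces as `0`). [cite: MoosbauerPoole2025, Thm. 4] -/
theorem moosbauerPoole2025_thm4 (ρ : G → Symmetry t)
    (hρ : ∀ (g : G) (T : ι → κ → μ → K), (ρ g).toLinearEquiv T = g • T)
    (S : Scheme t) (hS : IsInvariantUnder (Set.range ρ) S)
    (a : ι → K) (b b' : κ → K) (c c' : μ → K)
    (hT₁ : triad a b c ∈ S.elts) (hT₂ : triad a b' c' ∈ S.elts)
    (h₁ : (orbitFinset G (triad a b c)).card = Fintype.card G)
    (h₂ : (orbitFinset G (triad a b' c')).card = Fintype.card G)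
    (hne : triad a b' c' ∉ orbitFinset G (triad a b c)) :
    ∃ S' : Scheme t,
      S'.elts = S.elts - ((orbitFinset G (triad a b c)).val + (orbitFinset G (triad a b' c')).val) +
          (orbitPiece G (triad a b (c + c')) + orbitPiece G (triad a (b' - b) c')) ∧
      IsInvariantUnder (Set.range ρ) S' ∧
      S'.rank + 2 * Fintype.card G =
        S.rank + card (orbitPiece G (triad a b (c + c'))) +
          card (orbitPiece G (triad a (b' - b) c')) := by
  have hP : triad a b c + triad a b' c' = (triad a b (c + c') ::ₘ {triad a (b' - b) c'}).sum := by
    rw [Multiset.sum_cons, Multiset.sum_singleton, triad_add_triad_eq_flip₁']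
  obtain ⟨S', hS', hinv, hrank⟩ := moosbauerPoole2025_thm4_general ρ hρ S hS hT₁ hT₂ h₁ h₂ hne _ hP
    (by
      intro X hX
      rcases Multiset.mem_cons.mp hX with rfl | hX
      · exact ⟨_, _, _, rfl⟩
      · rw [Multiset.mem_singleton] at hX
        exact ⟨_, _, _, hX⟩)
  refine ⟨S', ?_, hinv, ?_⟩
  · rw [hS', Multiset.cons_bind, Multiset.singleton_bind]
  · rw [Multiset.cons_bind, Multiset.singleton_bind, Multiset.card_add, ← add_assoc] at hrank
    exact hrank

/-- **Orbit reduction** ("Since reductions are a special case of flips … Theorem 4 also holds for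
reductions"; MP Def. 3: `A = A'`, `B = B'`, the two tensors replaced by `A⊗B⊗(C+C')`): with
`A⊗B⊗C, A⊗B⊗C' ∈ S` representatives of two different full orbits,
`S' = S ∖ (G·A⊗B⊗C ∪ G·A⊗B⊗C') ∪ G·λA⊗B⊗(C+C')` is a `G`-invariant scheme of smaller rank.
[cite: MoosbauerPoole2025, Def. 3 and the paragraph after the proof of Thm. 4] -/
theorem moosbauerPoole2025_orbitReduction (ρ : G → Symmetry t)
    (hρ : ∀ (g : G) (T : ι → κ → μ → K), (ρ g).toLinearEquiv T = g • T)
    (S : Scheme t) (hS : IsInvariantUnder (Set.range ρ) S)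
    (a : ι → K) (b : κ → K) (c c' : μ → K)
    (hT₁ : triad a b c ∈ S.elts) (hT₂ : triad a b c' ∈ S.elts)
    (h₁ : (orbitFinset G (triad a b c)).card = Fintype.card G)
    (h₂ : (orbitFinset G (triad a b c')).card = Fintype.card G)
    (hne : triad a b c' ∉ orbitFinset G (triad a b c)) :
    ∃ S' : Scheme t,
      S'.elts = S.elts - ((orbitFinset G (triad a b c)).val + (orbitFinset G (triad a b c')).val) +
          orbitPiece G (triad a b (c + c')) ∧
      IsInvariantUnder (Set.range ρ) S' ∧ S'.rank + Fintype.card G ≤ S.rank := by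
  have hP : triad a b c + triad a b c' = ({triad a b (c + c')} : Multiset _).sum := by
    rw [Multiset.sum_singleton, triad_add_triad_eq_flip₁', sub_self]
    have h0 : triad a (0 : κ → K) c' = 0 := by
      funext x y z; simp [triad_apply]
    rw [h0, add_zero]
  obtain ⟨S', hS', hinv, hrank⟩ := moosbauerPoole2025_thm4_general ρ hρ S hS hT₁ hT₂ h₁ h₂ hne _ hP
    (fun X hX => ⟨a, b, c + c', (Multiset.mem_singleton.mp hX)⟩)
  refine ⟨S', by rw [hS', Multiset.singleton_bind], hinv, ?_⟩
  rw [Multiset.singleton_bind] at hrank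
  have hle := card_orbitPiece_le (G := G) (triad a b (c + c'))
  omega

/-- **Orbit plus-transition** ("… plus-transitions are an inverse reduction followed by a flip,
Theorem 4 also holds for … plus-transitions"; MP Def. 3: two tensors `A⊗B⊗C, A'⊗B'⊗C'` replaced by
`(A−A')⊗B⊗C, A'⊗B⊗(C+C'), A'⊗(B'−B)⊗C'`): with representatives of two different full orbits, removing
the two orbits and adding the three pieces `G·λ₁(A−A')⊗B⊗C`, `G·λ₂A'⊗B⊗(C+C')`, `G·λ₃A'⊗(B'−B)⊗C'`
gives a `G`-invariant scheme of `t`.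
[cite: MoosbauerPoole2025, Def. 3 and the paragraph after the proof of Thm. 4] -/
theorem moosbauerPoole2025_orbitPlusTransition (ρ : G → Symmetry t)
    (hρ : ∀ (g : G) (T : ι → κ → μ → K), (ρ g).toLinearEquiv T = g • T)
    (S : Scheme t) (hS : IsInvariantUnder (Set.range ρ) S)
    (a a' : ι → K) (b b' : κ → K) (c c' : μ → K)
    (hT₁ : triad a b c ∈ S.elts) (hT₂ : triad a' b' c' ∈ S.elts)
    (h₁ : (orbitFinset G (triad a b c)).card = Fintype.card G)
    (h₂ : (orbitFinset G (triad a' b' c')).card = Fintype.card G)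
    (hne : triad a' b' c' ∉ orbitFinset G (triad a b c)) :
    ∃ S' : Scheme t,
      S'.elts = S.elts - ((orbitFinset G (triad a b c)).val + (orbitFinset G (triad a' b' c')).val) +
          (orbitPiece G (triad (a - a') b c) + orbitPiece G (triad a' b (c + c')) +
            orbitPiece G (triad a' (b' - b) c')) ∧
      IsInvariantUnder (Set.range ρ) S' := by
  have hP : triad a b c + triad a' b' c' =
      (triad (a - a') b c ::ₘ triad a' b (c + c') ::ₘ {triad a' (b' - b) c'}).sum := by
    rw [Multiset.sum_cons, Multiset.sum_cons, Multiset.sum_singleton,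
      triad_add_triad_eq_plusTransition, add_assoc]
  obtain ⟨S', hS', hinv, -⟩ := moosbauerPoole2025_thm4_general ρ hρ S hS hT₁ hT₂ h₁ h₂ hne _ hP
    (by
      intro X hX
      rcases Multiset.mem_cons.mp hX with rfl | hX
      · exact ⟨_, _, _, rfl⟩
      rcases Multiset.mem_cons.mp hX with rfl | hX
      · exact ⟨_, _, _, rfl⟩
      · rw [Multiset.mem_singleton] at hX
        exact ⟨_, _, _, hX⟩)
  refine ⟨S', ?_, hinv⟩
  rw [hS', Multiset.cons_bind, Multiset.cons_bind, Multiset.singleton_bind, add_assoc]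

/-- **The special case of MP Thm. 4:** "A special case occurs if `G·A⊗B⊗(C+C') = G·A⊗(B'−B)⊗C`. In
this case we double `λ` and set `λ'` to `0`": if `Y = A⊗(B'−B)⊗C'` lies in the orbit of
`X = A⊗B⊗(C+C')`, then `S' = S ∖ (G·T₁ ∪ G·T₂) ∪ G·(2λ)X` is a `G`-invariant scheme of `t`.
[cite: MoosbauerPoole2025, Thm. 4 (proof, last paragraph)] -/
theorem moosbauerPoole2025_thm4_special (ρ : G → Symmetry t)
    (hρ : ∀ (g : G) (T : ι → κ → μ → K), (ρ g).toLinearEquiv T = g • T)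
    (S : Scheme t) (hS : IsInvariantUnder (Set.range ρ) S)
    (a : ι → K) (b b' : κ → K) (c c' : μ → K)
    (hT₁ : triad a b c ∈ S.elts) (hT₂ : triad a b' c' ∈ S.elts)
    (h₁ : (orbitFinset G (triad a b c)).card = Fintype.card G)
    (h₂ : (orbitFinset G (triad a b' c')).card = Fintype.card G)
    (hne : triad a b' c' ∉ orbitFinset G (triad a b c))
    (hXY : triad a (b' - b) c' ∈ orbitFinset G (triad a b (c + c'))) :
    ∃ S' : Scheme t,
      S'.elts = S.elts - ((orbitFinset G (triad a b c)).val + (orbitFinset G (triad a b' c')).val) +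
          orbitPieceWith G (2 * orbitCoeff G (triad a b (c + c'))) (triad a b (c + c')) ∧
      IsInvariantUnder (Set.range ρ) S' := by
  obtain ⟨g₀, hg₀⟩ := mem_orbitFinset.mp hXY
  -- `Σ_g g•Y = Σ_g g•X` for `Y = g₀ • X` (reindex the group by right multiplication with `g₀`)
  have hYsum : ∑ g : G, g • triad a (b' - b) c' = ∑ g : G, g • triad a b (c + c') := by
    rw [← hg₀]
    simp_rw [← mul_smul]
    exact Fintype.sum_equiv (Equiv.mulRight g₀) _ _ fun g => rfl
  have hN : (orbitPieceWith G (2 * orbitCoeff G (triad a b (c + c'))) (triad a b (c + c'))).sum =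
      ∑ g : G, g • (triad a b c + triad a b' c') := by
    rw [sum_orbitPieceWith, mul_nsmul', orbitCoeff_eq_stabCard, stabCard_smul_sum_orbitFinset,
      triad_add_triad_eq_flip₁']
    simp_rw [smul_add]
    rw [Finset.sum_add_distrib, hYsum, two_nsmul]
  obtain ⟨S', hS', hinv, -⟩ := moosbauerPoole2025_thm4_core ρ hρ S hS hT₁ hT₂ h₁ h₂ hne _ hN
    (fun g => map_smul_orbitPieceWith g _ _) (fun Y hY => ne_zero_of_mem_orbitPieceWith hY)
    (fun Y hY => exists_triad_of_mem_orbitPieceWith ρ hρ hY)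
  exact ⟨S', hS', hinv⟩

end Scheme

end FlipGraph

end Literature.Computability.AlgebraicComplexity
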